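import Summits.QuantumFields.BalabanUV.T4Continuum.Support.NE3QuadRemainderTower
import Summits.QuantumFields.BalabanUV.T4Continuum.Support.AveragingDeficitLocality
import HarnessLib

/-!
# T⁴ programme, node NE3, route Π item Π-C (file Π-C-3♭ «LOCALITY») — `relIter L k W X (z,κ)` AND `dirIter L k W X (z,κ)` DEPEND ON `X` ONLY
# THROUGH ITS RESTRICTION TO THE ℓ¹-BALL OF RADIUS `depRad d L k` ABOUT THE COARSE CORNER `L^k•z` (the block union feeding `(z,κ)`)

NE3 formalisation swarm `b2b-balaban-t4-ne3-formalise-*`, LEAF PROVER 02 (gen 7); the OWNER's ADDED ASK of ruling ρ-g25-1 (HOME/CLAIMS.log l.22520 (1),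
«Π-C-3♭ LOCALITY»): so that the k-free sup END of Π-C-3b (`NE3QuadRemainderSup.norm_relIter_sub_dirIter_le`, global `s = sup‖X‖`) yields the LOCAL form
`‖C_W(X)(z,κ)‖ ≤ C₂·(L^k·sup_{B̃(z,κ)}‖X‖)²` by applying it to a (periodised) cut-off of `X`.

CONTENT (all [folklore]; 0 sorry; ONE DATA def `depRad` by structural recursion): §1 configuration-level congruence of the tree's words and average —
`stepHol_congr`, `hol_congr` (two configurations agreeing on the bonds of the word have the same transport (9)), `Wcx_congr_of_l1`, **`bavg_congr_of_l1`**
(`U = U'` on the ℓ¹-ball of radius `nbRad d L = (2d+2)L` about `q` ⇒ `bavg L U q κ = bavg L U' q κ`), `dstep_congr`, `dhol_congr` (directions agreeing on the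
bonds of the word), `mlogDeriv_congr_of_l1`, **`pushDir_congr_of_l1`** (by formula: `pushDir`∕`sideDeriv`∕`XavgDeriv`∕`mlogDeriv`∕`dhol` read `ψ` only on the
ball); §2 one step on the unit lattice — `relStep_congr_of_l1`, `cpush_congr_of_l1` (radius `nbRad` about `L•y`); §3 `depRad d L 0 = 0`,
`depRad d L (k+1) = L·depRad d L k + nbRad d L`, `depRad_add_le` (`depRad d L k + nbRad ≤ nbRad·L^k` for `2 ≤ L`), and THE LOCALITY OF THE TOWERS —
**`relIter_congr_of_l1`**, **`dirIter_congr_of_l1`**: `X = X'` on `{x : l1 (x − L^k•z) ≤ depRad d L k}` ⇒ `relIter L k W X z κ = relIter L k W X' z κ`,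
`dirIter L k W X z κ = dirIter L k W X' z κ` (every `κ`; no class hypothesis — pure locality of the formulas).

HONEST FRAMING.  Formula bookkeeping on OUR frame; nothing about Bałaban's minimisers; `DecomposedRep`'s sizes, T-E_w♯, NE3 NOT proved; spine PROVED 0∕9;
finite T⁴ rung (B)+1 — NOT infinite volume, NOT mass gap, NOT BetaPertH, NOT Clay.  ABSOLUTE RULE kept (context only: [Balaban1985Averaging] (42) p. 23 «this
definition is local … depends only on the bond variables U_b, b ⊂ B^k(c₋) ∪ B^k(c₊)» p. 24, Prop. 4 p. 38).  PLACEMENT: `Summits/QuantumFields/BalabanUV/`.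
HONEST DEPENDENCY: continuum YM on T⁴ ⇐ BetaPertH ∧ nine spine estimates (0/9 proved); BetaPertH ⇐ (D1) ∧ (D4) ∧ CAP+tail; G-an2-4 gates asym, D1 and NE2/3/4.
-/

set_option autoImplicit false

open scoped BigOperators Matrix.Norms.L2Operator
open Finset

namespace Summit.QuantumFields.BalabanUV.T4Continuum.NE3QuadRemainderLocality

open Literature.MathematicalPhysics.QuantumFieldTheory.Balaban1983to89
open B7Prop1Explicit B7Prop2Explicit MatrixLog
open T4AveragingDeficitWall (vary Ad)
open AveragingDeficitChartCalculus (cavg)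
open AveragingDeficitTransport (dstep dhol dhol_nil dhol_cons)
open AveragingDeficitLocality (bondsOf bondsOf_nil bondsOf_cons l1_le_of_mem_bondsOf)
open AveragingDeficitSideDeriv (loopWord length_loopWord mlogDeriv XavgDeriv sideDeriv)
open AveragingDeficitResidualPairing (pushDir)
open AveragingDeficitMultiLevelPrep (cpush cavgIter)
open BlockAverageVaryHolo (nbRad length_loopWord_le length_seg_le)
open NE3TangentCovariantTower (dirIter)
open NE3QuadRemainderTower (relStep relIter)

noncomputable section

variable {d : ℕ} {n : Type*} [Fintype n] [DecidableEq n]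

/-! ## §1 Configuration-level congruence of words, loop variables, the average and its linearisation -/

/-- One letter: two configurations agreeing on the letter's bond give the same step. [folklore] -/
theorem stepHol_congr {U U' : Site d → Fin d → (Matrix n n ℂ)ˣ} (x : Site d) (l : Letter d)
    (h : U (if l.2 then x else x + l.vec) l.1 = U' (if l.2 then x else x + l.vec) l.1) : stepHol U x l = stepHol U' x l := by
  obtain ⟨μ, b⟩ := l
  cases b
  · simp only [Bool.false_eq_true, ↓reduceIte] at h
    simp only [stepHol, Bool.false_eq_true, ↓reduceIte, h]
  · simp only [↓reduceIte] at h
    simp only [stepHol, ↓reduceIte, h]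

/-- **Locality of (9)**: two configurations agreeing on every bond of the word have the same transport. [folklore] -/
theorem hol_congr {U U' : Site d → Fin d → (Matrix n n ℂ)ˣ} :
    ∀ (x : Site d) (w : List (Letter d)), (∀ b ∈ bondsOf x w, U b.1 b.2 = U' b.1 b.2) → hol U x w = hol U' x w
  | x, [], _ => by simp
  | x, l :: w, h => by
      rw [hol_cons, hol_cons, hol_congr (x + l.vec) w fun b hb => h b (by simp [hb]), stepHol_congr x l ?_]
      have := h (if l.2 then (x, l.1) else (x + l.vec, l.1)) (by simp)
      obtain ⟨μ, b⟩ := l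
      cases b <;> simpa using this

/-- Locality of (9) by distance: agreement on every bond starting within ℓ¹-distance `|w|` of `x` suffices. [folklore] -/
theorem hol_congr_of_l1 {U U' : Site d → Fin d → (Matrix n n ℂ)ˣ} (x : Site d) (w : List (Letter d))
    (h : ∀ (x' : Site d) (κ : Fin d), l1 (x' - x) ≤ w.length → U x' κ = U' x' κ) : hol U x w = hol U' x w :=
  hol_congr x w fun b hb => h b.1 b.2 (l1_le_of_mem_bondsOf x w b hb)

/-- **Locality of the loop variables of (42)**: agreement on the ℓ¹-ball of radius `nbRad d L` about `c₋ = q` suffices. [folklore] -/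
theorem Wcx_congr_of_l1 (L : ℕ) {U U' : Site d → Fin d → (Matrix n n ℂ)ˣ} (q : Site d) (κ : Fin d) (r : Fin d → Fin L)
    (h : ∀ (x' : Site d) (κ' : Fin d), l1 (x' - q) ≤ nbRad d L → U x' κ' = U' x' κ') :
    Wcx L U q κ (boxVec L r) = Wcx L U' q κ (boxVec L r) := by
  unfold Wcx
  have hlen : (gammaWord L κ (boxVec L r)).length ≤ nbRad d L := by
    rw [length_gammaWord]; have := l1_boxVec_le (L := L) r; unfold nbRad; nlinarith
  rw [hol_congr_of_l1 q _ fun x' κ' hx' => h x' κ' (hx'.trans hlen),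
    hol_congr_of_l1 (U := U) (U' := U') q _ fun x' κ' hx' => h x' κ' (hx'.trans ((length_seg_le (d := d) L κ)))]

/-- **LOCALITY OF THE AVERAGE (42)**: `bavg L U q κ = bavg L U' q κ` whenever `U = U'` on every bond starting within ℓ¹-distance `nbRad d L = (2d+2)L`
of `c₋ = q`. [cite: Balaban1985Averaging, (42)–(43) pp.23–24] -/
theorem bavg_congr_of_l1 (L : ℕ) {U U' : Site d → Fin d → (Matrix n n ℂ)ˣ} (q : Site d) (κ : Fin d)
    (h : ∀ (x' : Site d) (κ' : Fin d), l1 (x' - q) ≤ nbRad d L → U x' κ' = U' x' κ') : bavg L U q κ = bavg L U' q κ := by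
  unfold bavg Xavg
  have hW : ∀ r : Fin d → Fin L, Wcx L U q κ (boxVec L r) = Wcx L U' q κ (boxVec L r) := fun r => Wcx_congr_of_l1 L q κ r h
  simp only [hW]
  rw [hol_congr_of_l1 (U := U) (U' := U') q _ fun x' κ' hx' => h x' κ' (hx'.trans (length_seg_le (d := d) L κ))]

/-- One letter, linearised: two directions agreeing on the letter's bond give the same `dstep`. [folklore] -/
theorem dstep_congr (V : Site d → Fin d → (Matrix n n ℂ)ˣ) {ψ ψ' : Site d → Fin d → Matrix n n ℂ} (x : Site d) (l : Letter d)
    (h : ψ (if l.2 then x else x + l.vec) l.1 = ψ' (if l.2 then x else x + l.vec) l.1) : dstep V ψ x l = dstep V ψ' x l := by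
  obtain ⟨μ, b⟩ := l
  cases b
  · simp only [Bool.false_eq_true, ↓reduceIte] at h
    simp only [dstep, Bool.false_eq_true, ↓reduceIte, h]
  · simp only [↓reduceIte] at h
    simp only [dstep, ↓reduceIte, h]

/-- **Locality of the linearised transport**: two directions agreeing on every bond of the word give the same `dhol V · x w`. [folklore] -/
theorem dhol_congr (V : Site d → Fin d → (Matrix n n ℂ)ˣ) {ψ ψ' : Site d → Fin d → Matrix n n ℂ} :
    ∀ (x : Site d) (w : List (Letter d)), (∀ b ∈ bondsOf x w, ψ b.1 b.2 = ψ' b.1 b.2) → dhol V ψ x w = dhol V ψ' x w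
  | x, [], _ => by simp
  | x, l :: w, h => by
      rw [dhol_cons, dhol_cons, dhol_congr V (x + l.vec) w fun b hb => h b (by simp [hb]), dstep_congr V x l ?_]
      have := h (if l.2 then (x, l.1) else (x + l.vec, l.1)) (by simp)
      obtain ⟨μ, b⟩ := l
      cases b <;> simpa using this

/-- Locality of the linearised transport by distance. [folklore] -/
theorem dhol_congr_of_l1 (V : Site d → Fin d → (Matrix n n ℂ)ˣ) {ψ ψ' : Site d → Fin d → Matrix n n ℂ} (x : Site d) (w : List (Letter d))
    (h : ∀ (x' : Site d) (κ : Fin d), l1 (x' - x) ≤ w.length → ψ x' κ = ψ' x' κ) : dhol V ψ x w = dhol V ψ' x w :=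
  dhol_congr V x w fun b hb => h b.1 b.2 (l1_le_of_mem_bondsOf x w b hb)

/-- Locality of the loop-variable log-derivative `mlogDeriv` (it reads `ψ` through `vary V ψ s` inside the loop word). [folklore] -/
theorem mlogDeriv_congr_of_l1 (L : ℕ) (V : Site d → Fin d → (Matrix n n ℂ)ˣ) {ψ ψ' : Site d → Fin d → Matrix n n ℂ} (q : Site d)
    (κ : Fin d) (r : Fin d → Fin L) (h : ∀ (x' : Site d) (κ' : Fin d), l1 (x' - q) ≤ nbRad d L → ψ x' κ' = ψ' x' κ') :
    mlogDeriv L V ψ q κ (boxVec L r) = mlogDeriv L V ψ' q κ (boxVec L r) := by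
  unfold mlogDeriv
  have hW : ∀ s : ℝ, Wcx L (vary V ψ s) q κ (boxVec L r) = Wcx L (vary V ψ' s) q κ (boxVec L r) := fun s =>
    Wcx_congr_of_l1 L q κ r fun x' κ' hx' => by simp only [vary, h x' κ' hx']
  simp only [hW]

/-- **LOCALITY OF THE LINEARISED AVERAGE**: `pushDir L V ψ q κ = pushDir L V ψ' q κ` whenever `ψ = ψ'` on every bond starting within ℓ¹-distance `nbRad d L`
of `q` (by formula: `pushDir = Ad_{V̄⁻¹} δV̄`, `δV̄ = Ad_{e^{X_c}}(J_{X_c}(X_c′) + δV(Γ_c))`, `X_c′ = Σ_x L^{−d}·mlogDeriv`). [cite: Balaban1985Averaging, (42) p.23] -/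
theorem pushDir_congr_of_l1 (L : ℕ) (V : Site d → Fin d → (Matrix n n ℂ)ˣ) {ψ ψ' : Site d → Fin d → Matrix n n ℂ} (q : Site d) (κ : Fin d)
    (h : ∀ (x' : Site d) (κ' : Fin d), l1 (x' - q) ≤ nbRad d L → ψ x' κ' = ψ' x' κ') : pushDir L V ψ q κ = pushDir L V ψ' q κ := by
  have hX : XavgDeriv L V ψ q κ = XavgDeriv L V ψ' q κ := by
    unfold XavgDeriv
    exact Finset.sum_congr rfl fun r _ => by rw [mlogDeriv_congr_of_l1 L V q κ r h]
  have hseg : dhol V ψ q (seg κ L) = dhol V ψ' q (seg κ L) :=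
    dhol_congr_of_l1 V q _ fun x' κ' hx' => h x' κ' (hx'.trans (length_seg_le (d := d) L κ))
  unfold pushDir sideDeriv
  rw [hX, hseg]

/-! ## §2 One step on the unit lattice -/

/-- **LOCALITY OF `relStep`**: `X = X'` on the ℓ¹-ball of radius `nbRad d L` about `L•y` ⇒ `relStep L W X y κ = relStep L W X' y κ` (every `κ`). [folklore] -/
theorem relStep_congr_of_l1 (L : ℕ) (W : Site d → Fin d → (Matrix n n ℂ)ˣ) {X X' : Site d → Fin d → Matrix n n ℂ} (y : Site d)
    (h : ∀ (x : Site d) (μ : Fin d), l1 (x - (L : ℤ) • y) ≤ nbRad d L → X x μ = X' x μ) (κ : Fin d) :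
    relStep L W X y κ = relStep L W X' y κ := by
  unfold relStep
  have hb : cavg L (vary W X 1) y κ = cavg L (vary W X' 1) y κ :=
    bavg_congr_of_l1 L ((L : ℤ) • y) κ fun x' κ' hx' => by simp only [vary, h x' κ' hx']
  rw [hb]

/-- **LOCALITY OF `cpush`**: `X = X'` on the ℓ¹-ball of radius `nbRad d L` about `L•y` ⇒ `cpush L W X y κ = cpush L W X' y κ`. [folklore] -/
theorem cpush_congr_of_l1 (L : ℕ) (W : Site d → Fin d → (Matrix n n ℂ)ˣ) {X X' : Site d → Fin d → Matrix n n ℂ} (y : Site d)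
    (h : ∀ (x : Site d) (μ : Fin d), l1 (x - (L : ℤ) • y) ≤ nbRad d L → X x μ = X' x μ) (κ : Fin d) :
    cpush L W X y κ = cpush L W X' y κ :=
  pushDir_congr_of_l1 L W ((L : ℤ) • y) κ h

/-! ## §3 The dependency radius and the locality of the towers -/

/-- THE DEPENDENCY RADIUS of the k-fold towers about the coarse corner `L^k•z`: `depRad d L 0 = 0`, `depRad d L (k+1) = L·depRad d L k + nbRad d L`
(`= nbRad·Σ_{i<k} L^i`). [folklore] -/
def depRad (d L : ℕ) : ℕ → ℕ
  | 0 => 0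
  | k + 1 => L * depRad d L k + nbRad d L

omit [Fintype n] [DecidableEq n] in
/-- `depRad d L k + nbRad d L ≤ nbRad d L·L^k` for `2 ≤ L` (so the dependency ball is `O(1)` blocks of side `L^k`). [folklore] -/
theorem depRad_add_le {L : ℕ} (hL : 2 ≤ L) : ∀ k : ℕ, depRad d L k + nbRad d L ≤ nbRad d L * L ^ k
  | 0 => by simp [depRad]
  | k + 1 => by
      have ih := depRad_add_le hL k
      show L * depRad d L k + nbRad d L + nbRad d L ≤ nbRad d L * L ^ (k + 1)
      have h1 : L * (depRad d L k + nbRad d L) ≤ L * (nbRad d L * L ^ k) := Nat.mul_le_mul_left L ih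
      have h2 : 2 * nbRad d L ≤ L * nbRad d L := Nat.mul_le_mul_right _ hL
      rw [pow_succ]
      nlinarith [h1, h2]

omit [Fintype n] [DecidableEq n] in
/-- `l1 (L•v) ≤ L·l1 v` (in fact equality). [folklore] -/
theorem l1_natCast_smul_le (L : ℕ) (v : Site d) : l1 ((L : ℤ) • v) ≤ L * l1 v := by
  unfold l1
  rw [Finset.mul_sum]
  refine le_of_eq (Finset.sum_congr rfl fun i _ => ?_)
  simp [Int.natAbs_mul]

omit [Fintype n] [DecidableEq n] in
/-- Transfer of the ball one level down: `l1 (x − L•y) ≤ nbRad`, `l1 (y − L^k•z) ≤ depRad k` ⇒ `l1 (x − L^{k+1}•z) ≤ depRad (k+1)`. [folklore] -/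
theorem l1_le_depRad_succ (L k : ℕ) {x y z : Site d} (hx : l1 (x - (L : ℤ) • y) ≤ nbRad d L)
    (hy : l1 (y - ((L : ℤ) ^ k) • z) ≤ depRad d L k) : l1 (x - ((L : ℤ) ^ (k + 1)) • z) ≤ depRad d L (k + 1) := by
  have hsplit : x - ((L : ℤ) ^ (k + 1)) • z = (x - (L : ℤ) • y) + (L : ℤ) • (y - ((L : ℤ) ^ k) • z) := by
    rw [smul_sub, smul_smul, ← pow_succ']; abel
  have h1 := l1_add_le (x - (L : ℤ) • y) ((L : ℤ) • (y - ((L : ℤ) ^ k) • z))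
  have h2 := l1_natCast_smul_le (d := d) L (y - ((L : ℤ) ^ k) • z)
  rw [hsplit]
  show _ ≤ L * depRad d L k + nbRad d L
  have h3 : L * l1 (y - ((L : ℤ) ^ k) • z) ≤ L * depRad d L k := Nat.mul_le_mul_left L hy
  omega

/-- **LOCALITY OF THE k-FOLD RELATIVE LOG-COORDINATE**: if `X = X'` on every bond starting within ℓ¹-distance `depRad d L k` of the coarse corner `L^k•z`,
then `relIter L k W X z κ = relIter L k W X' z κ` for every `κ` (any `W`; no class hypothesis). [cite: Balaban1985Averaging, p.24, Prop. 4 p.38] -/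
theorem relIter_congr_of_l1 (L : ℕ) : ∀ (k : ℕ) (W : Site d → Fin d → (Matrix n n ℂ)ˣ) {X X' : Site d → Fin d → Matrix n n ℂ} (z : Site d),
    (∀ (x : Site d) (μ : Fin d), l1 (x - ((L : ℤ) ^ k) • z) ≤ depRad d L k → X x μ = X' x μ) →
    ∀ κ : Fin d, relIter L k W X z κ = relIter L k W X' z κ
  | 0, W, X, X', z, h, κ => by
      have := h z κ (by simp [depRad, l1])
      simpa [relIter] using this
  | k + 1, W, X, X', z, h, κ => by
      show relIter L k (cavg L W) (relStep L W X) z κ = relIter L k (cavg L W) (relStep L W X') z κ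
      refine relIter_congr_of_l1 L k (cavg L W) z (fun y μ hy => ?_) κ
      exact relStep_congr_of_l1 L W y (fun x μ' hx => h x μ' (l1_le_depRad_succ L k hx hy)) μ

/-- **LOCALITY OF THE k-FOLD LINEARISED AVERAGE**: the same for leaf-04's `dirIter L k W X z κ`. [cite: Balaban1985Averaging, p.24, (139)–(141) p.39] -/
theorem dirIter_congr_of_l1 (L : ℕ) : ∀ (k : ℕ) (W : Site d → Fin d → (Matrix n n ℂ)ˣ) {X X' : Site d → Fin d → Matrix n n ℂ} (z : Site d),
    (∀ (x : Site d) (μ : Fin d), l1 (x - ((L : ℤ) ^ k) • z) ≤ depRad d L k → X x μ = X' x μ) →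
    ∀ κ : Fin d, dirIter L k W X z κ = dirIter L k W X' z κ
  | 0, W, X, X', z, h, κ => by
      have := h z κ (by simp [depRad, l1])
      simpa [dirIter] using this
  | k + 1, W, X, X', z, h, κ => by
      show dirIter L k (cavg L W) (cpush L W X) z κ = dirIter L k (cavg L W) (cpush L W X') z κ
      refine dirIter_congr_of_l1 L k (cavg L W) z (fun y μ hy => ?_) κ
      exact cpush_congr_of_l1 L W y (fun x μ' hx => h x μ' (l1_le_depRad_succ L k hx hy)) μ

/-- **THE QUADRATIC REMAINDER IS LOCAL**: `X = X'` on the dependency ball ⇒ `C_W(X)(z,κ) = C_W(X')(z,κ)`. [folklore] -/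
theorem remainder_congr_of_l1 (L k : ℕ) (W : Site d → Fin d → (Matrix n n ℂ)ˣ) {X X' : Site d → Fin d → Matrix n n ℂ} (z : Site d)
    (h : ∀ (x : Site d) (μ : Fin d), l1 (x - ((L : ℤ) ^ k) • z) ≤ depRad d L k → X x μ = X' x μ) (κ : Fin d) :
    relIter L k W X z κ - dirIter L k W X z κ = relIter L k W X' z κ - dirIter L k W X' z κ := by
  rw [relIter_congr_of_l1 L k W z h κ, dirIter_congr_of_l1 L k W z h κ]

end

end Summit.QuantumFields.BalabanUV.T4Continuum.NE3QuadRemainderLocality
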